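import Summits.QuantumFields.YangMills.Theorems.BalabanUVNodesN05AtRecord12SubB

/-!
# BalabanUVNodes ∕ N05 ([B8], `Dag.B8_main`) AT THE STAGE-12 [B8″] RECORD — PROPOSITION 5's INDEX AT PRINT'S OWN RANGE: the ∃-currency face of
# `BalabanUVNodesN05AtRecord12SubB` §2 at the CANONICAL three-law index of ALL Proposition-5 data over the record's lattice (n05-c g3's subtype of
# `B8Prop5ExistsZdLan.prop5Exists_zdLanSub3_of_lettersRD`), which is INHABITED — answering referee ref-A g14 READ-16's A1 note («the cut layer's Prop.-5 index `J` is a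
# FREE type … the consumer must exhibit `Nonempty J` or the Prop.-5 rows are vacuous there»)

Track A of `YM-PLAN.md` (cell `pub-ymgap`, HUMAN RULING D-0062), node **N05** = [Balaban1985RegularSpaces]; seat `pub-ymgap-dag-n05-d` (g4), 2026-08-27.  Sequel of
`BalabanUVNodesN05AtRecord12SubB` (p489612; imports it only).  WHY.  §2 there is stated for an ARBITRARY index map `ι : J → ZdLanIdx θ.D θ.𝔸` with the three member laws;
at `J := Empty` the two Proposition-5 conjuncts of the leaf (`p5e`, `p5u` over `fun a : J => zdLan θ.L λ.B₁ (ι a)`) hold VACUOUSLY (ref-A g14 READ-16, A1 probe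
`(λ.cutSubB Empty (fun e => e.elim) c₁).I8c = Empty`).  Print's Proposition 5 (p. 94) is a sentence about EVERY datum «U₀ ∈ 𝔄_k({Ω_j}, α₀), u₁, U₁» over EVERY admitted
sequence `{Ω_j}` — so the honest index is the canonical subtype of ALL `ZdLanIdx` data obeying the three member laws the providers read (`Ω₀ = ℤᵈ`, `Ω_{j+1} ⊂ Ω_j`
(1.3) p. 77, «Bʲ(y) ⊂ Ω_j» for the constraint sets (1.5)–(1.6) p. 77), read through `Subtype.val`:
* §1 **`nonempty_zdLanIdxSub3`** — that subtype is INHABITED (the all-torus datum: `η = 1`, `k = 1`, `Ω_j = Λ_j = ℤᵈ`, `U₀ = 1`; kernel `rfl`∕`trivial` laws), so at this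
  index NO Proposition-5 row of the leaf is vacuous; `zdLanIdxSub3_val_laws` (the three laws BY NAME off `.2`).
* §2 ★ **`exists_isRecordOfRecord₁₂CB10YZWB8subBB12_b8_of_knit_lettersRDUB_sub3`** — p489612 §2 VERBATIM at `J :=` that subtype, `ι := Subtype.val` (laws from `.2`): for
  admissible Stage-12 parameters with provisos and the knit's inputs — [4]'s letters at the law members ∕ their cubes AND AT EVERY PROPOSITION-5 DATUM (`SLetL`, `SLetLU` now
  range over the whole canonical index), the b9 sockets, `p7`, `t8` — `∃ c₁ > 0, ∀ lam12 Mstar ops ζ lamW, ∀ γw ∈ ]0, θ.γ], ∃ w w′`: the six-pin [B8″] record of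
  `datumOfRecord₁₂ θ h` at `w` (binding displayed, Prop.-5 slot = `zdLan θ.L λ.B₁ ∘ Subtype.val` over ALL data), `∀ P, (leavesP w P).b8 ∧ Dag.B8_main (leavesP w P)`, and the
  same-datum `₁₂C` companion `w′`.
HONEST FRAMING: composition by name (one `exact`) + one inhabitation witness; [4]'s letters ×4 families, the b9 sockets, `p7`, `t8` remain HYPOTHESES; count-neutral; **N05 NOT
discharged**; Bałaban AS PRINTED with locators; one finite 𝕋⁴ programme at fixed ε; nothing continuum ∕ ℝ⁴ ∕ OS ∕ mass-gap ∕ Clay.  No `sorry`, no new definition.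
[cite: Balaban1985RegularSpaces, Prop. 5 (1.107)–(1.109) p.94 («for arbitrary U₀ ∈ 𝔄_k({Ω_j}, α₀)» — the datum's range), (1.3)–(1.6) p.77, p.89; Lemma 1 p.79 – Thm 8 p.101 (the knit); Balaban1985BackgroundPropagators, Thm 3.1 p.397, Thm 3.3 p.398 (letters and b9 socket, hypotheses); Balaban1989LargeFieldII, Thm 1 + (0.1) pp.355–356 (the record, bookkeeping)]
-/

noncomputable section

namespace Summit.QuantumFields.YangMills.BalabanUVNodes.N05AtRecord12SubBSub3

open Literature.MathematicalPhysics.QuantumFieldTheory.Balaban1983to89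
open Literature.MathematicalPhysics.QuantumFieldTheory.Balaban1983to89.Node00
open Literature.MathematicalPhysics.QuantumFieldTheory.Balaban1983to89.T4Continuum
open Literature.MathematicalPhysics.QuantumFieldTheory.Balaban1983to89.DagBinding
open Literature.MathematicalPhysics.QuantumFieldTheory.Balaban1983to89.B8IdxB8LawsB (towerBonds IdxB8LawsB IdxB8SubB famB8OfRecordSubB)
open Literature.MathematicalPhysics.QuantumFieldTheory.Balaban1983to89.B8LeafModelZd (ZdIdx)
open Literature.MathematicalPhysics.QuantumFieldTheory.Balaban1983to89.B8LeafModelZd3 (SockB9P3)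
open Literature.MathematicalPhysics.QuantumFieldTheory.Balaban1983to89.B8SockLettersRD (SockLettersRD)
open Literature.MathematicalPhysics.QuantumFieldTheory.Balaban1983to89.B8LeafKnitRS (B8LeafRS)
open Literature.MathematicalPhysics.QuantumFieldTheory.Balaban1983to89.B8Lemma1NonAbelian (blockPairNA)
open Literature.MathematicalPhysics.QuantumFieldTheory.Balaban1983to89.B8Eq131CubesAdmissible (cubeFam)
open Literature.MathematicalPhysics.QuantumFieldTheory.Balaban1983to89.B8CubeMemberZd (cubeLamS cubeLamB)
open Literature.MathematicalPhysics.QuantumFieldTheory.Balaban1983to89.B8Prop5LandauDataZd (ZdLanIdx zdLan)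
open Summit.QuantumFields.YangMills.BalabanUVNodes.N05AtRecord12SubB (exists_isRecordOfRecord₁₂CB10YZWB8subBB12_b8_of_knit_lettersRDUB)
open B7Prop1Explicit B7Prop2Explicit B7Prop1Local
open B8Ineq130 (tlo thi)
open B8Ineq132 (InAk covDerivFwd)
open B7Eq78Linearization (zdBlocking QprimeIter)
open B8Eq119TwistedAxial (bgT)
open B8Eq140Level (SideTouches)
open B8Eq138LandauZd (covLap QT)
open B8Eq1117Concrete (XSpace)
open B8Prop5ContractionKLevel (Bd2)
open B8LambdaSpaceKLevel (wt)

/-! ## §1. The canonical three-law index of Proposition-5 data is inhabited -/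

section Inhabited

/-- **THE CANONICAL THREE-LAW INDEX OF PROPOSITION-5 DATA IS INHABITED** over every Stage-3 dictionary: the all-torus datum (`η = 1`, `k = 1`, `Ω_j = Λ_j = ℤᵈ` for all `j`,
background `U₀ = 1`) obeys `Ω₀ = ℤᵈ`, `Ω_{j+1} ⊂ Ω_j` and «towers ⊂ Ω_j» trivially — print's admitted case «Ω_j = T_η» (p. 77).  So at this index no Proposition-5 row of the
leaf is vacuous (ref-A g14 READ-16 A1). [cite: Balaban1985RegularSpaces, p.77 («we admit the case where some domains Ω_j are equal to T_η»), (1.3)–(1.6) p.77, Prop. 5 p.94] -/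
theorem nonempty_zdLanIdxSub3 (θ : Stage3Params) :
    Nonempty {i : ZdLanIdx θ.D θ.𝔸 // i.Ω 0 = Set.univ ∧ (∀ j, i.Ω (j + 1) ⊆ i.Ω j) ∧
      ∀ j, j ≤ i.k → ∀ y ∈ i.Λ j, ∀ x, InBox (tlo θ.L y j) (thi θ.L y j) x → x ∈ i.Ω j} :=
  ⟨⟨{ η := 1, hη := one_pos, k := 1, hk := le_rfl, Ω := fun _ => Set.univ, Λ := fun _ => Set.univ, U₀ := 1,
      hU₀ := fun _ _ => (unitaryUnits θ.𝔸).one_mem },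
    rfl, fun _ => subset_rfl, fun _ _ _ _ x _ => Set.mem_univ x⟩⟩

/-- The three member laws of a canonical-index datum, BY NAME off its certificate (for feeding the providers' `hΩ0L` ∕ `hΩL` ∕ `htowerL` at `ι := Subtype.val`).
[cite: Balaban1985RegularSpaces, (1.3)–(1.6) p.77 (bookkeeping)] -/
theorem zdLanIdxSub3_val_laws (θ : Stage3Params)
    (a : {i : ZdLanIdx θ.D θ.𝔸 // i.Ω 0 = Set.univ ∧ (∀ j, i.Ω (j + 1) ⊆ i.Ω j) ∧
      ∀ j, j ≤ i.k → ∀ y ∈ i.Λ j, ∀ x, InBox (tlo θ.L y j) (thi θ.L y j) x → x ∈ i.Ω j}) :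
    a.1.Ω 0 = Set.univ ∧ (∀ j, a.1.Ω (j + 1) ⊆ a.1.Ω j) ∧ ∀ j, j ≤ a.1.k → ∀ y ∈ a.1.Λ j, ∀ x, InBox (tlo θ.L y j) (thi θ.L y j) x → x ∈ a.1.Ω j :=
  a.2

end Inhabited

/-! ## §2. N05 in ∃-currency at the six-pin [B8″] record with Proposition 5's carriers over ALL canonical data -/

section Record

variable {F : T4Family} {N : ℕ} [NeZero N]

/-- ★ **N05 IN ∃-CURRENCY AT THE STAGE-12 [B8″] RECORD, PROPOSITION 5 AT PRINT'S OWN RANGE** — `BalabanUVNodesN05AtRecord12SubB` §2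
(`exists_isRecordOfRecord₁₂CB10YZWB8subBB12_b8_of_knit_lettersRDUB`) VERBATIM at `J :=` the canonical three-law index of ALL Proposition-5 data over `θ.toStage3Params` (INHABITED,
§1) and `ι := Subtype.val` (member laws off `.2`): the [4]-letters binders at the Proposition-5 members (`SLetL` existence side, `SLetLU` guarded uniqueness side) now range over
EVERY datum `(η, k, {Ω_j}, {Λ_j}, U₀)` with `Ω₀ = ℤᵈ`, `Ω_{j+1} ⊂ Ω_j`, towers `⊂ Ω_j`; everything else (record constants, letters at the law members and their cubes, b9
sockets, `p7`, `t8`) as there.  CONCLUSION: `∃ c₁ > 0, ∀ lam12 Mstar ops ζ lamW, ∀ γw ∈ ]0, θ.γ], ∃ w w′` — the six-pin [B8″] record of `datumOfRecord₁₂ θ h` at `w` with its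
binding displayed (Prop.-5 slot `fun a => zdLan θ.L λ.B₁ a.1` over the whole index), `∀ P, (leavesP w P).b8 ∧ Dag.B8_main (leavesP w P)`, and the same-datum `₁₂C` companion
`w′` (leaves equal off `b8`; its typed `b8` not claimed).  NOT a discharge of N05: `p7`, `t8`, the four letters families and the b9 sockets are hypotheses.
[cite: Balaban1985RegularSpaces, Prop. 5 (1.107)–(1.109) p.94, (1.3)–(1.6) p.77; Lemma 1 p.79, Thm 2 p.83, Prop. 3 p.87, Thm 4 p.88, Prop. 6 p.99 (supplied inside the knit); Prop. 7 p.100, Thm 8 p.101 (named hypotheses); Balaban1985BackgroundPropagators, Thm 3.1 p.397, Thm 3.3 p.398 (letters and b9 socket, hypotheses); Balaban1989LargeFieldII, Thm 1 + (0.1) pp.355–356 (the record, bookkeeping)] -/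
theorem exists_isRecordOfRecord₁₂CB10YZWB8subBB12_b8_of_knit_lettersRDUB_sub3 (θ : Stage12Params F N) (h : θ.Provisos₁₂ F N) (hθ : θ.Admissible F N)
    (lam : ResidB8 θ.toStage3Params) (hD : 2 ≤ θ.toStage3Params.D)
    (hB₁' : lam.B₁' = 5 * (θ.toStage3Params.D : ℝ) * θ.toStage3Params.L * lam.inp.B₀) (hB₁ : 5 * (θ.toStage3Params.D : ℝ) * θ.toStage3Params.L * lam.inp.B₀ ≤ lam.B₁)
    {cB9 B₀'H B₂' BG BR cL : ℝ} (hB : 2 ≤ 5 * (θ.toStage3Params.D : ℝ) * θ.toStage3Params.L * lam.inp.B₀) (hB₀β : 0 < lam.B₀β) (hC₂ : 2097152 * ((θ.toStage3Params.D : ℝ) + 1) ^ 2 ≤ lam.C₂)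
    (hcB9 : 0 < cB9) (hB₀'H : 0 < B₀'H) (hB₂' : 0 ≤ B₂') (hBG : 0 ≤ BG) (hBR : 0 ≤ BR) (hcL : 0 < cL)
    (hfree : 3 * (2 * (θ.toStage3Params.D : ℝ) * (θ.toStage3Params.L : ℝ) ^ 2) * BG * BR ≤ lam.inp.B₀')
    -- the two constant conditions of the Prop.-5 provider
    (hB₁2 : 2 ≤ lam.B₁) (hfree2 : 3 * (2 * (θ.toStage3Params.D : ℝ) * (θ.toStage3Params.L : ℝ) ^ 2) * BG * BR ≤ lam.inp.B₀' / 2)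
    -- [4]'s letters at the LAW members: existence side (laws on print's domains) and uniqueness side
    (SLet : ∀ i : ZdIdx θ.toStage3Params.D θ.toStage3Params.L, IdxB8LawsB θ.toStage3Params.L i → SockLettersRD (𝔸 := θ.toStage3Params.𝔸) θ.toStage3Params.L BG BR B₀'H B₂' cL i.η i.k i.Ω i.Λs)
    (SLetUB : ∀ i : ZdIdx θ.toStage3Params.D θ.toStage3Params.L, IdxB8LawsB θ.toStage3Params.L i → ∀ α₀ : ℝ, 0 < α₀ → α₀ ≤ cL → ∀ U₀ : Site θ.toStage3Params.D → Fin θ.toStage3Params.D → θ.toStage3Params.𝔸ˣ, (∀ x κ, U₀ x κ ∈ unitaryUnits θ.toStage3Params.𝔸) →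
      InAk θ.toStage3Params.L i.k i.η α₀ i.Ω U₀ →
      ∃ (g Δ : (Site θ.toStage3Params.D → θ.toStage3Params.𝔸) →ₗ[ℂ] (Site θ.toStage3Params.D → θ.toStage3Params.𝔸)) (q : (Site θ.toStage3Params.D → θ.toStage3Params.𝔸) →ₗ[ℂ] (ℕ → Site θ.toStage3Params.D → θ.toStage3Params.𝔸))
        (qs : (ℕ → Site θ.toStage3Params.D → θ.toStage3Params.𝔸) →ₗ[ℂ] (Site θ.toStage3Params.D → θ.toStage3Params.𝔸)) (Aw c : (ℕ → Site θ.toStage3Params.D → θ.toStage3Params.𝔸) →ₗ[ℂ] (ℕ → Site θ.toStage3Params.D → θ.toStage3Params.𝔸))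
        (H' : XSpace θ.toStage3Params.D i.k θ.toStage3Params.𝔸 →ₗ[ℂ] (Site θ.toStage3Params.D → θ.toStage3Params.𝔸)),
        (∀ x : Site θ.toStage3Params.D → θ.toStage3Params.𝔸, (∃ C : ℝ, ∀ y, ‖x y‖ ≤ C) → g (Δ x + qs (Aw (q x))) = x) ∧ (∀ φ, qs (c (q (g (g (qs φ))))) = qs φ) ∧
        (∀ (f : Site θ.toStage3Params.D → θ.toStage3Params.𝔸), ∀ x ∈ i.Ω 0, Δ f x = covLap i.η U₀ ((i.Ω 0).indicator f) x) ∧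
        (∀ (μ : ℕ → Site θ.toStage3Params.D → θ.toStage3Params.𝔸), ∀ x ∈ i.Ω 0, qs μ x = QT θ.toStage3Params.L i.k (i.Λs i.k) U₀ μ x) ∧
        (∀ (f : Site θ.toStage3Params.D → θ.toStage3Params.𝔸) (n : ℕ), n ≤ i.k → ∀ y ∈ i.Λs i.k n, q f n y = QprimeIter (zdBlocking θ.toStage3Params.D θ.toStage3Params.L) (bgT θ.toStage3Params.L U₀) n f y) ∧
        (∀ (f : Site θ.toStage3Params.D → θ.toStage3Params.𝔸) (n : ℕ) (y : Site θ.toStage3Params.D), ¬ (n ≤ i.k ∧ y ∈ i.Λs i.k n) → q f n y = 0) ∧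
        (∀ (X : XSpace θ.toStage3Params.D i.k θ.toStage3Params.𝔸) (x : Site θ.toStage3Params.D), ‖H' X x‖ ≤ B₀'H * ‖X‖) ∧
        (∀ n, n ≤ i.k → ∀ (X : XSpace θ.toStage3Params.D i.k θ.toStage3Params.𝔸), ∀ p ∈ {b : Site θ.toStage3Params.D × Fin θ.toStage3Params.D | SideTouches (i.Ω n) b.1 b.2},
          wt θ.toStage3Params.L i.η n * ‖covDerivFwd i.η U₀ p.2 (H' X) p.1‖ ≤ B₀'H * ‖X‖) ∧
        (∀ X : XSpace θ.toStage3Params.D i.k θ.toStage3Params.𝔸, Bd2 θ.toStage3Params.L i.η i.k i.Ω (covLap i.η U₀ (H' X)) (B₂' * ‖X‖)) ∧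
        (∀ (Y : XSpace θ.toStage3Params.D i.k θ.toStage3Params.𝔸) (n : ℕ) (hn : n ≤ i.k) (y : Site θ.toStage3Params.D), y ∈ i.Λs i.k n →
          QprimeIter (zdBlocking θ.toStage3Params.D θ.toStage3Params.L) (bgT θ.toStage3Params.L U₀) n (H' Y) y = Y (⟨n, Nat.lt_succ_of_le hn⟩, y)) ∧
        (∀ (f : Site θ.toStage3Params.D → θ.toStage3Params.𝔸) (r : ℝ), 0 ≤ r → Bd2 θ.toStage3Params.L i.η i.k i.Ω f r →
          (∀ x, ‖g f x‖ ≤ BG * r) ∧ ∀ n, n ≤ i.k → ∀ p ∈ {b : Site θ.toStage3Params.D × Fin θ.toStage3Params.D | SideTouches (i.Ω n) b.1 b.2},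
            wt θ.toStage3Params.L i.η n * ‖covDerivFwd i.η U₀ p.2 (g f) p.1‖ ≤ BG * r) ∧
        (∀ (f : Site θ.toStage3Params.D → θ.toStage3Params.𝔸) (r : ℝ), 0 ≤ r → Bd2 θ.toStage3Params.L i.η i.k i.Ω f r → Bd2 θ.toStage3Params.L i.η i.k i.Ω (f - g (qs (c (q (g f))))) (BR * r)))
    (SB9all : ∀ i : ZdIdx θ.toStage3Params.D θ.toStage3Params.L, IdxB8LawsB θ.toStage3Params.L i → ∀ m, m ≤ i.k →
      SockB9P3 (𝔸 := θ.toStage3Params.𝔸) θ.toStage3Params.L lam.inp.B₀ lam.B₀β cB9 lam.β lam.len i.η m i.Ω i.Λs i.Λb)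
    -- AT EVERY CUBE of every law member: the existence letters and the b9 socket at the CUBE geometry (finite-Ω₀ members)
    (SLetC : ∀ i : ZdIdx θ.toStage3Params.D θ.toStage3Params.L, IdxB8LawsB θ.toStage3Params.L i → ∀ c : CubeB8 θ.toStage3Params.D θ.toStage3Params.L i.k i.Ω,
      SockLettersRD (𝔸 := θ.toStage3Params.𝔸) θ.toStage3Params.L BG BR B₀'H B₂' cL i.η c.k (cubeFam false θ.toStage3Params.L c.a c.M c.ρ c.k) (cubeLamS θ.toStage3Params.L c.a c.M c.ρ c.k))
    (SB9C : ∀ i : ZdIdx θ.toStage3Params.D θ.toStage3Params.L, IdxB8LawsB θ.toStage3Params.L i → ∀ c : CubeB8 θ.toStage3Params.D θ.toStage3Params.L i.k i.Ω, ∀ m, m ≤ c.k →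
      SockB9P3 (𝔸 := θ.toStage3Params.𝔸) θ.toStage3Params.L lam.inp.B₀ lam.B₀β cB9 lam.β lam.len i.η m (cubeFam false θ.toStage3Params.L c.a c.M c.ρ c.k) (cubeLamS θ.toStage3Params.L c.a c.M c.ρ c.k)
        (cubeLamB θ.toStage3Params.L c.a c.M c.ρ c.k))
    -- PROPOSITION 5's INDEX READ AS OBJECTS: `zdLan` members obeying the member laws, with [4]'s letters at each (RD currency)
    (SLetL : ∀ a : {i : ZdLanIdx θ.toStage3Params.D θ.toStage3Params.𝔸 // i.Ω 0 = Set.univ ∧ (∀ j, i.Ω (j + 1) ⊆ i.Ω j) ∧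
        ∀ j, j ≤ i.k → ∀ y ∈ i.Λ j, ∀ x, InBox (tlo θ.toStage3Params.L y j) (thi θ.toStage3Params.L y j) x → x ∈ i.Ω j}, ∀ α₀ : ℝ, 0 < α₀ → α₀ ≤ cL → InAk θ.toStage3Params.L a.1.k a.1.η α₀ a.1.Ω a.1.U₀ →
      ∃ (g Δ : (Site θ.toStage3Params.D → θ.toStage3Params.𝔸) →ₗ[ℂ] (Site θ.toStage3Params.D → θ.toStage3Params.𝔸)) (q : (Site θ.toStage3Params.D → θ.toStage3Params.𝔸) →ₗ[ℂ] (ℕ → Site θ.toStage3Params.D → θ.toStage3Params.𝔸))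
        (qs : (ℕ → Site θ.toStage3Params.D → θ.toStage3Params.𝔸) →ₗ[ℂ] (Site θ.toStage3Params.D → θ.toStage3Params.𝔸)) (Aw c : (ℕ → Site θ.toStage3Params.D → θ.toStage3Params.𝔸) →ₗ[ℂ] (ℕ → Site θ.toStage3Params.D → θ.toStage3Params.𝔸))
        (H' : XSpace θ.toStage3Params.D a.1.k θ.toStage3Params.𝔸 →ₗ[ℂ] (Site θ.toStage3Params.D → θ.toStage3Params.𝔸)),
        (∀ x, ∀ y ∈ a.1.Ω 0, (Δ (g x) + qs (Aw (q (g x)))) y = x y) ∧ (∀ f, q (g (g (qs (c (q f))))) = q f) ∧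
        (∀ (f : Site θ.toStage3Params.D → θ.toStage3Params.𝔸), ∀ x ∈ a.1.Ω 0, Δ f x = covLap a.1.η a.1.U₀ ((a.1.Ω 0).indicator f) x) ∧
        (∀ (μ : ℕ → Site θ.toStage3Params.D → θ.toStage3Params.𝔸), ∀ x ∈ a.1.Ω 0, qs μ x = QT θ.toStage3Params.L a.1.k a.1.Λ a.1.U₀ μ x) ∧
        (∀ (f : Site θ.toStage3Params.D → θ.toStage3Params.𝔸) (j : ℕ), j ≤ a.1.k → ∀ y ∈ a.1.Λ j, q f j y = QprimeIter (zdBlocking θ.toStage3Params.D θ.toStage3Params.L) (bgT θ.toStage3Params.L a.1.U₀) j f y) ∧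
        (∀ (X : XSpace θ.toStage3Params.D a.1.k θ.toStage3Params.𝔸) (x : Site θ.toStage3Params.D), ‖H' X x‖ ≤ B₀'H * ‖X‖) ∧
        (∀ j, j ≤ a.1.k → ∀ (X : XSpace θ.toStage3Params.D a.1.k θ.toStage3Params.𝔸), ∀ p ∈ {b : Site θ.toStage3Params.D × Fin θ.toStage3Params.D | SideTouches (a.1.Ω j) b.1 b.2},
          wt θ.toStage3Params.L a.1.η j * ‖covDerivFwd a.1.η a.1.U₀ p.2 (H' X) p.1‖ ≤ B₀'H * ‖X‖) ∧
        (∀ X : XSpace θ.toStage3Params.D a.1.k θ.toStage3Params.𝔸, Bd2 θ.toStage3Params.L a.1.η a.1.k a.1.Ω (covLap a.1.η a.1.U₀ (H' X)) (B₂' * ‖X‖)) ∧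
        (∀ (X : XSpace θ.toStage3Params.D a.1.k θ.toStage3Params.𝔸) (x : Site θ.toStage3Params.D), x ∉ a.1.Ω 0 → H' X x = 0) ∧
        (∀ X Y : XSpace θ.toStage3Params.D a.1.k θ.toStage3Params.𝔸, (∀ p, Y p = -star (X p)) → ∀ x, H' Y x = -star (H' X x)) ∧
        (∀ (Y : XSpace θ.toStage3Params.D a.1.k θ.toStage3Params.𝔸) (j : ℕ) (hj : j ≤ a.1.k) (y : Site θ.toStage3Params.D), y ∈ a.1.Λ j →
          QprimeIter (zdBlocking θ.toStage3Params.D θ.toStage3Params.L) (bgT θ.toStage3Params.L a.1.U₀) j (H' Y) y = Y (⟨j, Nat.lt_succ_of_le hj⟩, y)) ∧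
        (∀ (f : Site θ.toStage3Params.D → θ.toStage3Params.𝔸) (r : ℝ), 0 ≤ r → Bd2 θ.toStage3Params.L a.1.η a.1.k a.1.Ω f r →
          (∀ x, ‖g f x‖ ≤ BG * r) ∧ ∀ j, j ≤ a.1.k → ∀ p ∈ {b : Site θ.toStage3Params.D × Fin θ.toStage3Params.D | SideTouches (a.1.Ω j) b.1 b.2},
            wt θ.toStage3Params.L a.1.η j * ‖covDerivFwd a.1.η a.1.U₀ p.2 (g f) p.1‖ ≤ BG * r) ∧
        (∀ (f : Site θ.toStage3Params.D → θ.toStage3Params.𝔸) (x : Site θ.toStage3Params.D), x ∉ a.1.Ω 0 → g f x = 0) ∧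
        (∀ f : Site θ.toStage3Params.D → θ.toStage3Params.𝔸, (∀ j, j ≤ a.1.k → ∀ x ∈ a.1.Ω j, IsSelfAdjoint (f x)) → ∀ x, IsSelfAdjoint (g f x)) ∧
        (∀ (f : Site θ.toStage3Params.D → θ.toStage3Params.𝔸) (r : ℝ), 0 ≤ r → Bd2 θ.toStage3Params.L a.1.η a.1.k a.1.Ω f r →
          Bd2 θ.toStage3Params.L a.1.η a.1.k a.1.Ω (f - g (qs (c (q (g f))))) (BR * r)) ∧
        (∀ f : Site θ.toStage3Params.D → θ.toStage3Params.𝔸, (∀ j, j ≤ a.1.k → ∀ x ∈ a.1.Ω j, IsSelfAdjoint (f x)) →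
          ∀ j, j ≤ a.1.k → ∀ x ∈ a.1.Ω j, IsSelfAdjoint ((f - g (qs (c (q (g f))))) x)))
    -- [4]'s UNIQUENESS letters at the Prop-5 members (left-inverse law of G′ on bounded functions), for Prop. 5's uniqueness clause there
    (SLetLU : ∀ a : {i : ZdLanIdx θ.toStage3Params.D θ.toStage3Params.𝔸 // i.Ω 0 = Set.univ ∧ (∀ j, i.Ω (j + 1) ⊆ i.Ω j) ∧
        ∀ j, j ≤ i.k → ∀ y ∈ i.Λ j, ∀ x, InBox (tlo θ.toStage3Params.L y j) (thi θ.toStage3Params.L y j) x → x ∈ i.Ω j}, ∀ α₀ : ℝ, 0 < α₀ → α₀ ≤ cL → InAk θ.toStage3Params.L a.1.k a.1.η α₀ a.1.Ω a.1.U₀ →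
      ∃ (g Δ : (Site θ.toStage3Params.D → θ.toStage3Params.𝔸) →ₗ[ℂ] (Site θ.toStage3Params.D → θ.toStage3Params.𝔸)) (q : (Site θ.toStage3Params.D → θ.toStage3Params.𝔸) →ₗ[ℂ] (ℕ → Site θ.toStage3Params.D → θ.toStage3Params.𝔸)) (qs : (ℕ → Site θ.toStage3Params.D → θ.toStage3Params.𝔸) →ₗ[ℂ] (Site θ.toStage3Params.D → θ.toStage3Params.𝔸))
        (Aw c : (ℕ → Site θ.toStage3Params.D → θ.toStage3Params.𝔸) →ₗ[ℂ] (ℕ → Site θ.toStage3Params.D → θ.toStage3Params.𝔸)) (H' : XSpace θ.toStage3Params.D a.1.k θ.toStage3Params.𝔸 →ₗ[ℂ] (Site θ.toStage3Params.D → θ.toStage3Params.𝔸)),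
        (∀ x : Site θ.toStage3Params.D → θ.toStage3Params.𝔸, (∃ C : ℝ, ∀ y, ‖x y‖ ≤ C) → g (Δ x + qs (Aw (q x))) = x) ∧ (∀ φ, qs (c (q (g (g (qs φ))))) = qs φ) ∧
        (∀ (f : Site θ.toStage3Params.D → θ.toStage3Params.𝔸), ∀ x ∈ a.1.Ω 0, Δ f x = covLap a.1.η a.1.U₀ ((a.1.Ω 0).indicator f) x) ∧
        (∀ (μ : ℕ → Site θ.toStage3Params.D → θ.toStage3Params.𝔸), ∀ x ∈ a.1.Ω 0, qs μ x = QT θ.toStage3Params.L a.1.k a.1.Λ a.1.U₀ μ x) ∧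
        (∀ (f : Site θ.toStage3Params.D → θ.toStage3Params.𝔸) (n : ℕ), n ≤ a.1.k → ∀ y ∈ a.1.Λ n, q f n y = QprimeIter (zdBlocking θ.toStage3Params.D θ.toStage3Params.L) (bgT θ.toStage3Params.L a.1.U₀) n f y) ∧
        (∀ (f : Site θ.toStage3Params.D → θ.toStage3Params.𝔸) (n : ℕ) (y : Site θ.toStage3Params.D), ¬ (n ≤ a.1.k ∧ y ∈ a.1.Λ n) → q f n y = 0) ∧
        (∀ (X : XSpace θ.toStage3Params.D a.1.k θ.toStage3Params.𝔸) (x : Site θ.toStage3Params.D), ‖H' X x‖ ≤ B₀'H * ‖X‖) ∧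
        (∀ n, n ≤ a.1.k → ∀ (X : XSpace θ.toStage3Params.D a.1.k θ.toStage3Params.𝔸), ∀ p ∈ {b : Site θ.toStage3Params.D × Fin θ.toStage3Params.D | SideTouches (a.1.Ω n) b.1 b.2},
          wt θ.toStage3Params.L a.1.η n * ‖covDerivFwd a.1.η a.1.U₀ p.2 (H' X) p.1‖ ≤ B₀'H * ‖X‖) ∧
        (∀ X : XSpace θ.toStage3Params.D a.1.k θ.toStage3Params.𝔸, Bd2 θ.toStage3Params.L a.1.η a.1.k a.1.Ω (covLap a.1.η a.1.U₀ (H' X)) (B₂' * ‖X‖)) ∧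
        (∀ (Y : XSpace θ.toStage3Params.D a.1.k θ.toStage3Params.𝔸) (n : ℕ) (hn : n ≤ a.1.k) (y : Site θ.toStage3Params.D), y ∈ a.1.Λ n →
          QprimeIter (zdBlocking θ.toStage3Params.D θ.toStage3Params.L) (bgT θ.toStage3Params.L a.1.U₀) n (H' Y) y = Y (⟨n, Nat.lt_succ_of_le hn⟩, y)) ∧
        (∀ (f : Site θ.toStage3Params.D → θ.toStage3Params.𝔸) (r : ℝ), 0 ≤ r → Bd2 θ.toStage3Params.L a.1.η a.1.k a.1.Ω f r →
          (∀ x, ‖g f x‖ ≤ BG * r) ∧ ∀ n, n ≤ a.1.k → ∀ p ∈ {b : Site θ.toStage3Params.D × Fin θ.toStage3Params.D | SideTouches (a.1.Ω n) b.1 b.2},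
            wt θ.toStage3Params.L a.1.η n * ‖covDerivFwd a.1.η a.1.U₀ p.2 (g f) p.1‖ ≤ BG * r) ∧
        (∀ (f : Site θ.toStage3Params.D → θ.toStage3Params.𝔸) (r : ℝ), 0 ≤ r → Bd2 θ.toStage3Params.L a.1.η a.1.k a.1.Ω f r →
          Bd2 θ.toStage3Params.L a.1.η a.1.k a.1.Ω (f - g (qs (c (q (g f))))) (BR * r)))
    -- the two remaining printed members
    (p7 : B8SectGH.Prop7PrintedR (fun j : IdxB8SubB θ.toStage3Params => famB8OfRecordSubB θ.toStage3Params lam.β lam.len j) (fun j => lam.toAxial j.1))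
    (t8 : B8Thm8Surviving.Thm8SurvivingAt 1 lam.B₁ lam.B₂ (fun j : IdxB8SubB θ.toStage3Params => famB8OfRecordSubB θ.toStage3Params lam.β lam.len j)) :
    ∃ c₁ : ℝ, 0 < c₁ ∧ ∀ (lam12 : ResidB12 F N θ.τ9.M) (Mstar : ℕ) (ops : OpsY N θ.toStage3Params Mstar) (ζ : ResidZ F N) (lamW : ResidW F N) (γw : ℝ),
      0 < γw → γw ≤ θ.γ →
        ∃ w w' : WorldP, IsRecordOfRecord₁₂CB10YZWB8subBB12 F N (datumOfRecord₁₂ F N θ h) w ∧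
          w.C = (datumOfRecord₁₂ F N θ h).C ∧ w.γ = γw ∧ w.L = (θ.L : ℝ) ∧
          (∀ P : B12.RunParams, w.up P =
            upOfRecord₅CS F N (θ.view₁₂B12B8subBB10YZW F N lam12
              (lam.cutSubB {i : ZdLanIdx θ.toStage3Params.D θ.toStage3Params.𝔸 // i.Ω 0 = Set.univ ∧ (∀ j, i.Ω (j + 1) ⊆ i.Ω j) ∧
        ∀ j, j ≤ i.k → ∀ y ∈ i.Λ j, ∀ x, InBox (tlo θ.toStage3Params.L y j) (thi θ.toStage3Params.L y j) x → x ∈ i.Ω j}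
                (fun a => zdLan θ.toStage3Params.L lam.B₁ a.1) c₁) Mstar ops ζ lamW) P) ∧
          (∀ P : B12.RunParams, (leavesP w P).b8 ∧ Dag.B8_main (leavesP w P)) ∧
          IsRecordOfRecord₁₂C F N (datumOfRecord₁₂ F N θ h) w' ∧ w'.C = w.C ∧ w'.γ = w.γ ∧ w'.L = w.L ∧
          ∀ P : B12.RunParams, leavesP w P = { leavesP w' P with b8 := (leavesP w P).b8 } :=
  exists_isRecordOfRecord₁₂CB10YZWB8subBB12_b8_of_knit_lettersRDUB θ h hθ lam hD hB₁' hB₁ hB hB₀β hC₂ hcB9 hB₀'H hB₂' hBG hBR hcL hfree hB₁2 hfree2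
      SLet SLetUB SB9all SLetC SB9C Subtype.val (fun a => a.2.1) (fun a => a.2.2.1) (fun a => a.2.2.2) SLetL SLetLU p7 t8

end Record

#print axioms nonempty_zdLanIdxSub3
#print axioms exists_isRecordOfRecord₁₂CB10YZWB8subBB12_b8_of_knit_lettersRDUB_sub3

end Summit.QuantumFields.YangMills.BalabanUVNodes.N05AtRecord12SubBSub3

end
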